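import Summits.ResolutionOfSingularities.ResolutionOfSingularities.Theorems.FrobeniusClosingPatchingRelPerfectConeTiltFamilyCharts
import HarnessLib

/-!
# Crux `PatchingRelPerfect` (stmt-ResolutionOfSingularities-16161), chain w52 — ALL weight-two-
# permissible perturbations of the cone at depth two: `(x₀x₁ + x₂² + g) + 𝔪⁴`, `g ∈ (x₀,x₁,x₂)·𝔪²`
# — level-one chart identities

[OURS · L1 W5.2 · rung] The definitive form of this seat's tilt family (`…ConeTiltFamily*.lean`,
`g = x₃μ`, `μ ∈ P𝔪`): the perturbation class is widened to ALL `g ∈ P·𝔪²`, `P = (x₀, x₁, x₂)` —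
exactly the cubic-and-higher perturbations of `q = x₀x₁ + x₂²` that keep the vertex `z₀` of the
cone weight-two-permissible (modulo `𝔪⁴`, `𝔪³ = P𝔪² ⊕ κ·x₃³`; the complementary `x₃³`-direction is
the contact-migration case of this seat's hand note).  On the Rees chart `B_i` of `Bl_𝔪`:
`φ(g) = u³ m` with `m ∈ (e₀, e₁, e₂)` (`exists_tilt_of_mem`), the residual is `(F + u m, u²)`, and
the level-two files of the tilt family (`…ConeTiltFamilyLevelTwo.lean`, abstract tilt
`m ∈ (v₀, v₁, v₂)`) apply unchanged.  Identities, any ring: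

* `exists_tilt_of_mem`, `chartBase_q_add`, `map_chartBase_I2g`, `map_chartBase_L'g`,
  `map_chartBase_I2Qg`, `map_chartBase_I2Qg_of_ne_three`.

FORMAT evidence for the core only; nothing here is a statement of the manuscript under review.

## References

* The Stacks Project, Tags 080A, 0804. [StacksProject]
* Q. Liu, *Algebraic Geometry and Arithmetic Curves*, OUP 2002, Thm. 8.1.19 (a). [Liu2002]
-/

-- `Summit.<Summit>.<Sub>.Theorems` with `Sub = Summit` (single-conjunct summit, D-0017)
set_option linter.dupNamespace false

noncomputable section

open CategoryTheory CategoryTheory.Limits AlgebraicGeometry Literature.AlgebraicGeometry.Resolution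
open IsLocalRing

namespace Summit.ResolutionOfSingularities.ResolutionOfSingularities.Theorems

namespace ConeRung

universe u

/-! ## Level one: `I = (q + g) + 𝔪⁴`, `g ∈ P·𝔪²`, on the Rees charts of `Bl_𝔪` -/

section LevelOne

variable {S : Type u} [CommRing S] (x : Fin 4 → S) (g : S) (i : Fin 4) (m : chartRing x i)

local notation3 "M" => Ideal.span (Set.range x)
local notation3 "I2g" => Ideal.span {x 0 * x 1 + x 2 ^ 2 + g} ⊔ Ideal.span (Set.range x) ^ 4
local notation3 "PP" => Ideal.span {x 0, x 1, x 2}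
local notation3 "φ" => chartBase x i
local notation3 "u" => chartBase x i (x i)
local notation3 "e[" j "]" => chartGen x i j
local notation3 "F" => chartGen x i 0 * chartGen x i 1 + chartGen x i 2 ^ 2

/-- **The perturbation on a chart**: for `g ∈ P·𝔪²`, `φ(g) = u³ m` with `m ∈ (e₀, e₁, e₂)`.
[cite: StacksProject, Tag 0804] -/
theorem exists_tilt_of_mem (hg : g ∈ PP * M ^ 2) :
    ∃ m : chartRing x i, m ∈ Ideal.span {e[0], e[1], e[2]} ∧ φ g = u ^ 3 * m := by
  have h1 : φ g ∈ (PP * M ^ 2).map φ := Ideal.mem_map_of_mem _ hg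
  rw [Ideal.map_mul, Ideal.map_pow, map_chartBase_P, map_chartBase_M, mul_assoc,
    mul_comm (Ideal.span {e[0], e[1], e[2]}), ← mul_assoc, ← pow_succ',
    Ideal.span_singleton_pow, Ideal.mem_span_singleton_mul] at h1
  obtain ⟨m₀, hm₀, hm₀'⟩ := h1
  exact ⟨m₀, hm₀, hm₀'.symm⟩

/-- `φ(q + g) = u² (F + u m)` when `φ(g) = u³ m`. [folklore] -/
theorem chartBase_q_add (hm : φ g = u ^ 3 * m) :
    φ (x 0 * x 1 + x 2 ^ 2 + g) = u ^ 2 * (F + u * m) := by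
  rw [map_add, chartBase_q, hm]
  ring

/-- **`I B_i = u² · ((F + u m) + (u²))`**. [folklore] -/
theorem map_chartBase_I2g (hm : φ g = u ^ 3 * m) :
    (I2g).map φ = Ideal.span {u} ^ 2 * (Ideal.span {F + u * m} ⊔ Ideal.span {u} ^ 2) := by
  rw [Ideal.map_sup, Ideal.map_pow, map_chartBase_M, Ideal.map_span, Set.image_singleton,
    chartBase_q_add x g i m hm, span_pow_mul, Ideal.mul_sup, ← pow_add]

/-- **`(I + 𝔪² (P + 𝔪²)) B_i = u² · ((F + u m) + u · (u, e₀, e₁, e₂))`**. [folklore] -/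
theorem map_chartBase_L'g (hm : φ g = u ^ 3 * m) :
    (I2g ⊔ M ^ 2 * (PP ⊔ M ^ 2)).map φ =
      Ideal.span {u} ^ 2 *
        (Ideal.span {F + u * m} ⊔ Ideal.span {u} * Ideal.span {u, e[0], e[1], e[2]}) := by
  rw [Ideal.map_sup, map_chartBase_I2g x g i m hm, Ideal.map_mul, Ideal.map_pow, map_chartBase_M,
    map_chartBase_PM, ← Ideal.mul_sup, sup_assoc]
  have hle : Ideal.span {u} ^ 2 ≤ Ideal.span {u} * Ideal.span {u, e[0], e[1], e[2]} := by
    rw [sq]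
    exact Ideal.mul_mono_right (Ideal.span_mono (Set.singleton_subset_iff.mpr (Set.mem_insert _ _)))
  rw [sup_eq_right.mpr hle]

/-- **The total transform of `I · Q`** on every chart. [folklore] -/
theorem map_chartBase_I2Qg (hm : φ g = u ^ 3 * m) :
    (I2g * ((PP ⊔ M ^ 2) * (I2g ⊔ M ^ 2 * (PP ⊔ M ^ 2)))).map φ =
      Ideal.span {u ^ 5} *
        (((Ideal.span {F + u * m} ⊔ Ideal.span {u} * Ideal.span {u, e[0], e[1], e[2]}) *
            (Ideal.span {F + u * m} ⊔ Ideal.span {u} ^ 2)) *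
          Ideal.span {u, e[0], e[1], e[2]}) := by
  rw [Ideal.map_mul, Ideal.map_mul, map_chartBase_I2g x g i m hm, map_chartBase_PM,
    map_chartBase_L'g x g i m hm, ← Ideal.span_singleton_pow]
  ring

/-- **On the charts `i = 0, 1, 2`: `(I Q) B_i = u⁵ · (u, F + u m) · ((F + u m) + (u²))`**.
[folklore] -/
theorem map_chartBase_I2Qg_of_ne_three (hi : i ≠ 3) (hm : φ g = u ^ 3 * m) :
    (I2g * ((PP ⊔ M ^ 2) * (I2g ⊔ M ^ 2 * (PP ⊔ M ^ 2)))).map φ =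
      Ideal.span {u ^ 5} *
        (Ideal.span {u, F + u * m} * (Ideal.span {F + u * m} ⊔ Ideal.span {u ^ 2})) := by
  rw [map_chartBase_I2Qg x g i m hm, span_u_e_eq_top_of_ne_three x i hi, Ideal.mul_top,
    Ideal.mul_top, Ideal.span_insert u {F + u * m}, sup_comm (Ideal.span {u}) _,
    Ideal.span_singleton_pow]

end LevelOne

end ConeRung

end Summit.ResolutionOfSingularities.ResolutionOfSingularities.Theorems

end
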